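import Mathlib
import Summits.Ventures.PercRepro2.K5K3Pattern
import Summits.Ventures.PercRepro2.K5TypedK3
import Summits.Ventures.PercRepro2.K5TypedSimple

/-!
# TRANSFER OF THE TYPED `K₃` BASE TO EVERY ALL-MARKED SIMPLE TYPED GRAPH
(blind cell PercRepro2, typer-1 g10; p2's subtraction 03:22:27Z, lead g26 03:29:09Z)

With the pattern map of `K5K3Pattern.lean` (`m : V → Fin 5` injective on the marks `M`, `F` loop-free and
parallel-free with every end a mark, every edge off `F` pinned closed):

* `K3_patternM`: on triples closed off `F`, p1's kernel `K₃` of `G` at marks `o, a₁, a₂, a₃, b` is the kernel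
  of `K₅` at the marks `m o, …, m b` along the pattern map (every indicator of `K₃` is a connection event
  between marks: `indicator_connEvent_patternM`, `indicator_avoidAll_patternM`, `indicator_PDEvent_patternM`);
* `typedCount_patternM_eq`: the typed triples of `(F, z ≡ false, τ)` on `G` are in bijection with the typed
  triples of the minor `(minorFM, z ≡ false, minorτM τ)` of `K₅`; `typedCount_K3_transfer` combines both;
* **`typedCount_K3_nonneg_of_marks`**: for five marks with `a₁, a₂` distinct from every other mark and
  `o ≠ a₃` (p2's `MarksDistinct`: `b = a₃` and `o = b` allowed; the vertex map `markMap` sends them to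
  `(0, 1, 2, 3, 4)`, `(0, 1, 2, 3, 3)` or `(0, 1, 2, 3, 0)`), every typed count
  `typedCount F (fun _ => false) τ (K3 ends o a₁ a₂ a₃ b)` on an all-marked, loop-free, parallel-free `F`
  is `≥ 0`, given the three `K₅` certificates `Cert3 4`, `Cert3 3`, `Cert3 0` — the all-marked instances of
  `ResidualCore` (instantiated in `K5TypedK3Marks.lean`).
-/

namespace Summit.Ventures.PercRepro2

open Hub

namespace K5

/-! ## The kernel `K₃` along the pattern map -/

section Kernel

variable {V : Type*} {E : Type*} [Fintype E] [DecidableEq E] [DecidableEq V]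
variable (m : V → Fin 5) (ends : E → Sym2 V) (F : Finset E) {M : Set V}
variable {R : Type*} [Field R]

omit [Fintype E] [DecidableEq E] in
/-- Indicators of events agree along an equivalence of memberships. -/
lemma indicator_eq_of_iff {X : Set (Config E)} {Y : Set (Config (Fin 10))} {ω : Config E}
    {σ : Config (Fin 10)} (h : ω ∈ X ↔ σ ∈ Y) :
    X.indicator (1 : Config E → R) ω = Y.indicator (1 : Config (Fin 10) → R) σ := by
  by_cases hω : ω ∈ X
  · rw [Set.indicator_of_mem hω, Set.indicator_of_mem (h.1 hω)]
    rfl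
  · rw [Set.indicator_of_notMem hω, Set.indicator_of_notMem (fun h' => hω (h.2 h'))]

omit [Fintype E] [DecidableEq V] in
/-- The indicator of a connection event, along the pattern map. -/
lemma indicator_connEvent_patternM (hinj : Set.InjOn m M) (hM : ∀ e ∈ F, ∀ v ∈ ends e, v ∈ M)
    (hloop : ∀ e ∈ F, ¬ (ends e).IsDiag) {ω : Config E} (hω : ClosedOff F ω) {u v : V} (hu : u ∈ M)
    (hv : v ∈ M) :
    (connEvent ends u v).indicator (1 : Config E → R) ω =
      (connEvent ends5 (m u) (m v)).indicator (1 : Config (Fin 10) → R) (patternM m ends F ω) := by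
  refine indicator_eq_of_iff ?_
  rw [mem_connEvent, mem_connEvent]
  exact conn_iff_patternM m ends F hinj hM hloop hω hu hv

omit [Fintype E] [DecidableEq V] in
/-- The indicator of `Q = {a₁ ↮ a₂}`, along the pattern map. -/
lemma indicator_avoidAll_patternM (hinj : Set.InjOn m M) (hM : ∀ e ∈ F, ∀ v ∈ ends e, v ∈ M)
    (hloop : ∀ e ∈ F, ¬ (ends e).IsDiag) {ω : Config E} (hω : ClosedOff F ω) {a₁ a₂ : V} (h1 : a₁ ∈ M)
    (h2 : a₂ ∈ M) :
    (avoidAll ends a₂ {a₁}).indicator (1 : Config E → R) ω =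
      (avoidAll ends5 (m a₂) {m a₁}).indicator (1 : Config (Fin 10) → R) (patternM m ends F ω) := by
  refine indicator_eq_of_iff ?_
  simp only [mem_avoidAll, Finset.mem_singleton, forall_eq]
  rw [conn_iff_patternM m ends F hinj hM hloop hω h2 h1]

omit [Fintype E] [DecidableEq V] in
/-- The indicator of `PD`, along the pattern map. -/
lemma indicator_PDEvent_patternM (hinj : Set.InjOn m M) (hM : ∀ e ∈ F, ∀ v ∈ ends e, v ∈ M)
    (hloop : ∀ e ∈ F, ¬ (ends e).IsDiag) {ω : Config E} (hω : ClosedOff F ω) {a₁ a₂ a₃ : V}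
    (h1 : a₁ ∈ M) (h2 : a₂ ∈ M) (h3 : a₃ ∈ M) :
    (PDEvent ends a₁ a₂ a₃).indicator (1 : Config E → R) ω =
      (PDEvent ends5 (m a₁) (m a₂) (m a₃)).indicator (1 : Config (Fin 10) → R)
        (patternM m ends F ω) := by
  refine indicator_eq_of_iff ?_
  simp only [PDEvent, Dtilde, UnionCluster.inU, Set.mem_inter_iff, Set.mem_compl_iff, Set.mem_union,
    mem_connEvent]
  rw [conn_iff_patternM m ends F hinj hM hloop hω h1 h2, conn_iff_patternM m ends F hinj hM hloop hω h3 h1,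
    conn_iff_patternM m ends F hinj hM hloop hω h3 h2]

omit [Fintype E] [DecidableEq V] in
/-- **The kernel `K₃` of `G` is the kernel of `K₅` along the pattern map**, on triples closed off `F`. -/
theorem K3_patternM (hinj : Set.InjOn m M) (hM : ∀ e ∈ F, ∀ v ∈ ends e, v ∈ M)
    (hloop : ∀ e ∈ F, ¬ (ends e).IsDiag) {o a₁ a₂ a₃ b : V} (ho : o ∈ M) (h1 : a₁ ∈ M) (h2 : a₂ ∈ M)
    (h3 : a₃ ∈ M) (hb : b ∈ M) {x y w : Config E} (hx : ClosedOff F x) (hy : ClosedOff F y)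
    (hw : ClosedOff F w) :
    CovForm.K3 (R := R) ends o a₁ a₂ a₃ b x y w =
      CovForm.K3 (R := R) ends5 (m o) (m a₁) (m a₂) (m a₃) (m b)
        (patternM m ends F x) (patternM m ends F y) (patternM m ends F w) := by
  unfold CovForm.K3 CovForm.sepKernel CovForm.f3 CovForm.f4 CovForm.f5 CovForm.f6 CovForm.f7 CovForm.f10
    CovForm.f11 CovForm.f12 CovForm.sigma CovForm.inU CovForm.iQ CovForm.iPD CovForm.iL CovForm.iH
  simp only [Fin.sum_univ_succ, Fin.sum_univ_zero, Matrix.cons_val_zero, Matrix.cons_val_succ, add_zero,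
    indicator_connEvent_patternM m ends F hinj hM hloop hx, indicator_connEvent_patternM m ends F hinj hM hloop hy,
    indicator_connEvent_patternM m ends F hinj hM hloop hw, indicator_avoidAll_patternM m ends F hinj hM hloop hx,
    indicator_avoidAll_patternM m ends F hinj hM hloop hy, indicator_avoidAll_patternM m ends F hinj hM hloop hw,
    indicator_PDEvent_patternM m ends F hinj hM hloop hx, indicator_PDEvent_patternM m ends F hinj hM hloop hy,
    indicator_PDEvent_patternM m ends F hinj hM hloop hw, ho, h1, h2, h3, hb]

end Kernel

/-! ## The typed triples transfer -/

section Counts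

variable {E : Type*} [Fintype E] [DecidableEq E] {R : Type*} [CommRing R]

/-- Two kernels agreeing on triples closed off `F` have the same typed count at `z ≡ false`. -/
lemma typedCount_congr_closedOff (F : Finset E) (τ : E → ℕ)
    (K K' : Config E → Config E → Config E → R)
    (h : ∀ x y w, K5.ClosedOff F x → K5.ClosedOff F y → K5.ClosedOff F w → K x y w = K' x y w) :
    typedCount F (fun _ => false) τ K = typedCount F (fun _ => false) τ K' := by
  unfold typedCount
  refine Finset.sum_congr rfl fun x _ => Finset.sum_congr rfl fun y _ =>
    Finset.sum_congr rfl fun w _ => ?_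
  by_cases hc : (∀ e, e ∉ F → x e = false ∧ y e = false ∧ w e = false) ∧
      (∀ e ∈ F, openCount x y w e = τ e)
  · rw [if_pos hc, if_pos hc]
    exact h x y w (fun e he => (hc.1 e he).1) (fun e he => (hc.1 e he).2.1) (fun e he => (hc.1 e he).2.2)
  · rw [if_neg hc, if_neg hc]

end Counts

section Transfer

variable {V : Type*} {E : Type*} [Fintype E] [DecidableEq E] [DecidableEq V]
variable (m : V → Fin 5) (ends : E → Sym2 V) (F : Finset E) {M : Set V}
variable {R : Type*} [CommRing R]

omit [DecidableEq V] in
/-- **The typed triples of `(F, z ≡ false, τ)` on `G` are the typed triples of the minor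
`(minorFM, z ≡ false, minorτM τ)` of `K₅`**: for any kernel `K` on `K₅`, the typed counts of its pull-back
along the pattern map agree. -/
theorem typedCount_patternM_eq (hinj : Set.InjOn m M) (hM : ∀ e ∈ F, ∀ v ∈ ends e, v ∈ M)
    (hloop : ∀ e ∈ F, ¬ (ends e).IsDiag) (hpar : ∀ e ∈ F, ∀ e' ∈ F, ends e = ends e' → e = e')
    (K : Config (Fin 10) → Config (Fin 10) → Config (Fin 10) → R) (τ : E → ℕ) :
    typedCount F (fun _ => false) τ
        (fun x y w => K (patternM m ends F x) (patternM m ends F y) (patternM m ends F w)) =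
      typedCount (minorFM m ends F) (fun _ => false) (minorτM m ends F τ) K := by
  rw [typedCount_eq_sum_triples, typedCount_eq_sum_triples]
  refine sum_ite_nbij _ _ _ _
    (fun t => (patternM m ends F t.1, patternM m ends F t.2.1, patternM m ends F t.2.2)) _ _ ?_ ?_ ?_ ?_
  · rintro t ⟨hoff, hon⟩
    refine ⟨?_, ?_⟩
    · intro j hj
      by_cases hb : ∃ e, e ∈ bundleM m ends F j
      · obtain ⟨e, he⟩ := hb
        have heF : e ∉ F := fun heF => hj ((mem_minorFM m ends F).2 ⟨e, heF, he⟩)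
        obtain ⟨h1, h2, h3⟩ := hoff e heF
        simp only [patternM_of_mem m ends F hinj hM hpar he, h1, h2, h3, and_self]
      · have hb' : ∀ e, e ∉ bundleM m ends F j := fun e he => hb ⟨e, he⟩
        simp only [patternM_of_empty m ends F hb', and_self]
    · intro j hj
      obtain ⟨e, heF, he⟩ := (mem_minorFM m ends F).1 hj
      rw [minorτM_of_mem m ends F hinj hM hpar he, ← hon e heF]
      unfold openCount
      simp only [patternM_of_mem m ends F hinj hM hpar he]
  · rintro t t' ⟨hoff, -⟩ ⟨hoff', -⟩ h
    simp only [Prod.mk.injEq] at h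
    obtain ⟨h1, h2, h3⟩ := h
    have c1 : ∀ e, e ∉ F → t.1 e = false := fun e he => (hoff e he).1
    have c2 : ∀ e, e ∉ F → t.2.1 e = false := fun e he => (hoff e he).2.1
    have c3 : ∀ e, e ∉ F → t.2.2 e = false := fun e he => (hoff e he).2.2
    have c1' : ∀ e, e ∉ F → t'.1 e = false := fun e he => (hoff' e he).1
    have c2' : ∀ e, e ∉ F → t'.2.1 e = false := fun e he => (hoff' e he).2.1
    have c3' : ∀ e, e ∉ F → t'.2.2 e = false := fun e he => (hoff' e he).2.2
    exact Prod.ext (patternM_injOn m ends F hinj hM hloop hpar c1 c1' h1)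
      (Prod.ext (patternM_injOn m ends F hinj hM hloop hpar c2 c2' h2)
        (patternM_injOn m ends F hinj hM hloop hpar c3 c3' h3))
  · rintro t' ⟨hoff, hon⟩
    have hvan : ∀ σ ∈ ({t'.1, t'.2.1, t'.2.2} : Finset (Fin 10 → Bool)),
        ∀ j, (∀ e, e ∉ bundleM m ends F j) → σ j = false := by
      intro σ hσ j hj
      have hjF : j ∉ minorFM m ends F := fun hjF => by
        obtain ⟨e, -, he⟩ := (mem_minorFM m ends F).1 hjF
        exact hj e he
      obtain ⟨h1, h2, h3⟩ := hoff j hjF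
      simp only [Finset.mem_insert, Finset.mem_singleton] at hσ
      rcases hσ with rfl | rfl | rfl
      · exact h1
      · exact h2
      · exact h3
    refine ⟨(liftM m ends F t'.1, liftM m ends F t'.2.1, liftM m ends F t'.2.2), ⟨?_, ?_⟩, ?_⟩
    · intro e heF
      exact ⟨liftM_closedOff m ends F _ e heF, liftM_closedOff m ends F _ e heF,
        liftM_closedOff m ends F _ e heF⟩
    · intro e heF
      obtain ⟨j, he⟩ := exists_bundleM m ends F hinj hM hloop heF
      have hjF : j ∈ minorFM m ends F := (mem_minorFM m ends F).2 ⟨e, heF, he⟩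
      have := hon j hjF
      rw [minorτM_of_mem m ends F hinj hM hpar he] at this
      rw [← this]
      unfold openCount
      simp only [liftM_apply m ends F he]
    · simp only
      rw [patternM_liftM m ends F hinj hM hpar _ (hvan _ (by simp)),
        patternM_liftM m ends F hinj hM hpar _ (hvan _ (by simp)),
        patternM_liftM m ends F hinj hM hpar _ (hvan _ (by simp))]
  · intro t _
    rfl

end Transfer

/-! ## The theorem -/

section Theorem

variable {V : Type*} {E : Type*} [Fintype E] [DecidableEq E] [DecidableEq V]
variable {R : Type*} [Field R] [LinearOrder R] [IsStrictOrderedRing R]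

omit [DecidableEq V] [LinearOrder R] [IsStrictOrderedRing R] in
/-- **The typed counts of `K₃` on an all-marked simple typed graph are typed counts of `K₃` on `K₅`.** -/
theorem typedCount_K3_transfer (m : V → Fin 5) (ends : E → Sym2 V) (F : Finset E) {M : Set V}
    (hinj : Set.InjOn m M) (hM : ∀ e ∈ F, ∀ v ∈ ends e, v ∈ M)
    (hloop : ∀ e ∈ F, ¬ (ends e).IsDiag) (hpar : ∀ e ∈ F, ∀ e' ∈ F, ends e = ends e' → e = e')
    {o a₁ a₂ a₃ b : V} (ho : o ∈ M) (h1 : a₁ ∈ M) (h2 : a₂ ∈ M) (h3 : a₃ ∈ M) (hb : b ∈ M) (τ : E → ℕ) :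
    typedCount F (fun _ => false) τ (CovForm.K3 (R := R) ends o a₁ a₂ a₃ b) =
      typedCount (minorFM m ends F) (fun _ => false) (minorτM m ends F τ)
        (CovForm.K3 (R := R) ends5 (m o) (m a₁) (m a₂) (m a₃) (m b)) := by
  rw [← typedCount_patternM_eq m ends F hinj hM hloop hpar]
  exact typedCount_congr_closedOff F τ _ _ fun x y w hx hy hw =>
    K3_patternM m ends F hinj hM hloop ho h1 h2 h3 hb hx hy hw

/-- The vertex map of a marking: `o ↦ 0, a₁ ↦ 1, a₂ ↦ 2, a₃ ↦ 3, b ↦ 4` (a coincidence `b = o` / `b = a₃`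
sends `b` to `0` / `3`), every other vertex to `0`. -/
def markMap (o a₁ a₂ a₃ b : V) (v : V) : Fin 5 :=
  if v = o then 0 else if v = a₁ then 1 else if v = a₂ then 2 else if v = a₃ then 3 else
    if v = b then 4 else 0

/-- The marks. -/
def marks (o a₁ a₂ a₃ b : V) : Set V := {o, a₁, a₂, a₃, b}

/-- The inverse of the vertex map on the marks. -/
def markInv (o a₁ a₂ a₃ b : V) : Fin 5 → V := ![o, a₁, a₂, a₃, b]

omit [Fintype E] [DecidableEq E] in
/-- `markInv` inverts `markMap` on the marks (`a₁, a₂` distinct from every other mark, `o ≠ a₃`). -/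
lemma markInv_markMap {o a₁ a₂ a₃ b : V} (h12 : a₁ ≠ a₂) (h31 : a₃ ≠ a₁) (h32 : a₃ ≠ a₂) (ho1 : o ≠ a₁)
    (ho2 : o ≠ a₂) (hb1 : b ≠ a₁) (hb2 : b ≠ a₂) (ho3 : o ≠ a₃) {v : V} (hv : v ∈ marks o a₁ a₂ a₃ b) :
    markInv o a₁ a₂ a₃ b (markMap o a₁ a₂ a₃ b v) = v := by
  simp only [marks, Set.mem_insert_iff, Set.mem_singleton_iff] at hv
  unfold markMap markInv
  rcases hv with rfl | rfl | rfl | rfl | rfl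
  · simp
  · simp [ho1.symm]
  · simp [ho2.symm, h12.symm]
  · simp [ho3.symm, h31, h32]
  · by_cases hbo : v = o
    · simp [hbo]
    · by_cases hb3 : v = a₃
      · simp [hb3, ho3.symm, h31, h32]
      · simp [hbo, hb1, hb2, hb3]

omit [Fintype E] [DecidableEq E] in
/-- `markMap` is injective on the marks. -/
lemma markMap_injOn {o a₁ a₂ a₃ b : V} (h12 : a₁ ≠ a₂) (h31 : a₃ ≠ a₁) (h32 : a₃ ≠ a₂) (ho1 : o ≠ a₁)
    (ho2 : o ≠ a₂) (hb1 : b ≠ a₁) (hb2 : b ≠ a₂) (ho3 : o ≠ a₃) :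
    Set.InjOn (markMap o a₁ a₂ a₃ b) (marks o a₁ a₂ a₃ b) := by
  intro x hx y hy h
  rw [← markInv_markMap h12 h31 h32 ho1 ho2 hb1 hb2 ho3 hx, ← markInv_markMap h12 h31 h32 ho1 ho2 hb1 hb2 ho3 hy,
    h]

omit [Fintype E] [DecidableEq E] in
/-- The images of the marks. -/
lemma markMap_o (o a₁ a₂ a₃ b : V) : markMap o a₁ a₂ a₃ b o = 0 := by simp [markMap]

omit [Fintype E] [DecidableEq E] in
/-- The image of `a₁` is `1`. -/
lemma markMap_a₁ {o a₁ a₂ a₃ b : V} (ho1 : o ≠ a₁) : markMap o a₁ a₂ a₃ b a₁ = 1 := by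
  simp [markMap, ho1.symm]

omit [Fintype E] [DecidableEq E] in
/-- The image of `a₂` is `2`. -/
lemma markMap_a₂ {o a₁ a₂ a₃ b : V} (h12 : a₁ ≠ a₂) (ho2 : o ≠ a₂) : markMap o a₁ a₂ a₃ b a₂ = 2 := by
  simp [markMap, ho2.symm, h12.symm]

omit [Fintype E] [DecidableEq E] in
/-- The image of `a₃` is `3`. -/
lemma markMap_a₃ {o a₁ a₂ a₃ b : V} (h31 : a₃ ≠ a₁) (h32 : a₃ ≠ a₂) (ho3 : o ≠ a₃) :
    markMap o a₁ a₂ a₃ b a₃ = 3 := by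
  simp [markMap, ho3.symm, h31, h32]

omit [Fintype E] [DecidableEq E] in
/-- The image of `b` is `4`, `3` (`b = a₃`) or `0` (`b = o`). -/
lemma markMap_b {o a₁ a₂ a₃ b : V} (h31 : a₃ ≠ a₁) (h32 : a₃ ≠ a₂) (hb1 : b ≠ a₁) (hb2 : b ≠ a₂)
    (ho3 : o ≠ a₃) :
    markMap o a₁ a₂ a₃ b b = 4 ∨ markMap o a₁ a₂ a₃ b b = 3 ∨ markMap o a₁ a₂ a₃ b b = 0 := by
  unfold markMap
  by_cases hbo : b = o
  · simp [hbo]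
  · by_cases hb3 : b = a₃
    · simp [hb3, ho3.symm, h31, h32]
    · simp [hbo, hb1, hb2, hb3]

/-- **THE TYPED `K₃` BASE ON EVERY ALL-MARKED, LOOP-FREE, PARALLEL-FREE TYPED GRAPH**, given the three
`K₅` certificates: for marks with `a₁, a₂` distinct from every other mark and `o ≠ a₃` (`b = a₃` and
`o = b` allowed), every typed count at `z ≡ false` is nonnegative. -/
theorem typedCount_K3_nonneg_of_marks (c4 : Cert3 4) (c3 : Cert3 3) (c0 : Cert3 0)
    (ends : E → Sym2 V) {o a₁ a₂ a₃ b : V} (h12 : a₁ ≠ a₂) (h31 : a₃ ≠ a₁) (h32 : a₃ ≠ a₂) (ho1 : o ≠ a₁)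
    (ho2 : o ≠ a₂) (hb1 : b ≠ a₁) (hb2 : b ≠ a₂) (ho3 : o ≠ a₃) (F : Finset E) (τ : E → ℕ)
    (hloop : ∀ e ∈ F, ¬ (ends e).IsDiag) (hpar : ∀ e ∈ F, ∀ e' ∈ F, ends e = ends e' → e = e')
    (hall : ∀ e ∈ F, ∀ v ∈ ends e, v = o ∨ v = a₁ ∨ v = a₂ ∨ v = a₃ ∨ v = b) :
    0 ≤ typedCount F (fun _ => false) τ (CovForm.K3 (R := R) ends o a₁ a₂ a₃ b) := by
  have hM : ∀ e ∈ F, ∀ v ∈ ends e, v ∈ marks o a₁ a₂ a₃ b := by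
    intro e he v hv
    simp only [marks, Set.mem_insert_iff, Set.mem_singleton_iff]
    exact hall e he v hv
  have hinj := markMap_injOn h12 h31 h32 ho1 ho2 hb1 hb2 ho3
  have ho : o ∈ marks o a₁ a₂ a₃ b := by simp [marks]
  have h1 : a₁ ∈ marks o a₁ a₂ a₃ b := by simp [marks]
  have h2 : a₂ ∈ marks o a₁ a₂ a₃ b := by simp [marks]
  have h3 : a₃ ∈ marks o a₁ a₂ a₃ b := by simp [marks]
  have hb : b ∈ marks o a₁ a₂ a₃ b := by simp [marks]
  rw [typedCount_K3_transfer (markMap o a₁ a₂ a₃ b) ends F hinj hM hloop hpar ho h1 h2 h3 hb τ,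
    markMap_o, markMap_a₁ ho1, markMap_a₂ h12 ho2, markMap_a₃ h31 h32 ho3]
  rcases markMap_b h31 h32 hb1 hb2 ho3 with h | h | h <;> rw [h]
  · exact typedCount_K3_nonneg_of_cert 4 c4 _ _ _
  · exact typedCount_K3_nonneg_of_cert 3 c3 _ _ _
  · exact typedCount_K3_nonneg_of_cert 0 c0 _ _ _

end Theorem

end K5

end Summit.Ventures.PercRepro2
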